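import Literature.Combinatorics.LorentzianPolynomials.Basic
import HarnessLib

/-!
# The polynomial `Σ_{i_1,…,i_d} F(i_1, …, i_d) w_{i_1} ⋯ w_{i_d}` of a symmetric function of words, and the
# common skeleton of Brändén–Huh's Theorems 4.1 / 4.6: positive symmetric values with Lorentzian
# `2`-slices give a Lorentzian polynomial

Layer `Literature/Combinatorics/LorentzianPolynomials`, namespace `Literature.Combinatorics.LorentzianPolynomials`;
lane `lit-hodgefound` (Track 2 foundations library), seat p16, generation 27 (row g27-#2). Sequel of `Basic.lean`
(row g27-#1: `IsMConvex`, `normCoeff`, `hessian`, `lorentzian σ d` = `L^d_n` by Brändén–Huh's Def. 2.6,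
`mem_lorentzian_two`, `mem_lorentzian_add_three`, `zero_mem_lorentzian`).

## Source (verbatim) — P. Brändén, J. Huh, *Lorentzian polynomials* [BrandenHuh2019] (held `paper:arxiv-1902.03719`)

* §4.1 (p. 46): "`vol_K(w) = Σ_{1 ≤ i_1, …, i_d ≤ n} V(K_{i_1}, …, K_{i_d}) w_{i_1} ⋯ w_{i_d} = Σ_{α ∈ Δ^d_n} (d!/α!) V_α(K) w^α`
  […] the mixed volume `V(C_1, C_2, …, C_d)` is symmetric in its arguments"; **Theorem 4.1** "The volume polynomial
  `vol_K` is a Lorentzian polynomial"; its proof (p. 47): "every coefficient of `vol_K` is positive. Thus, by Theorem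
  2.25, it is enough to show that `∂^α vol` is Lorentzian for every `α ∈ Δ^{d-2}_n` […]
  `(2!/d!) ∂^α vol_K(w) = V(Σ_i w_i K_i, Σ_i w_i K_i, K_1, …, K_1, …, K_n, …, K_n)`".
* §4.2 **Theorem 4.6** (p. 49): "If `H_1, …, H_n` are nef divisors on `Y`, then `vol_H(w)` is a Lorentzian polynomial",
  proof (pp. 49–50): "every coefficient of `vol_H` is positive. Thus, by Theorem 2.25, it is enough to show that
  `∂^α vol_H` is Lorentzian for every `α ∈ Δ^{d-2}_n`. Note that
  `(2!/d!) ∂^α vol_H(w) = (Σ_i w_i H_i · Σ_i w_i H_i · H_1 ⋯ H_1 ⋯ H_n ⋯ H_n)` […] the Hodge index theorem […] shows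
  that the displayed quadratic form has exactly one positive eigenvalue."
* §4.1 (p. 48): "The *complete homogeneous form* of `f` is the multi-linear function `F_f : (ℝ^n)^d → ℝ` […] the
  complete homogeneous form of `f` is symmetric in its arguments", **Proposition 4.5** and its proof:
  "`v_i^T 𝓗 v_j = D_i D_j D_3 ⋯ D_d f = d! F_f(v_i, v_j, v_3, …, v_d)`" (the Hessian of a `(d-2)`-fold derivative is
  `d!` times a `2`-slice of the symmetric form).
* §2.2 Definition 2.6 (p. 12): `L^d_n = {f ∈ M^d_n | ∂_i f ∈ L^{d-1}_n for all i}` — the recursion followed here.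

## What is here (index type `σ` finite — Brändén–Huh's `[n]`)

Both proofs have the same shape: a function `F` of words `(i_1, …, i_d) ∈ [n]^d` — the mixed volume
`V(K_{i_1}, …, K_{i_d})`, the intersection number `(H_{i_1} ⋯ H_{i_d})` — which is SYMMETRIC, POSITIVE, and whose
`2`-slices `(a, b) ↦ F(i_1, …, i_{d-2}, a, b)` are quadratic forms with at most one positive eigenvalue
(Alexandrov–Fenchel / Hodge index); then `f = Σ_u F(u) w_u ∈ L^d_n`. This file proves that statement once, for an
arbitrary such `F` (the geometric inputs are supplied by the lane's torus files):

* §1 `content u = Σ_k e_{u_k} ∈ Δ^d` (the exponent of the monomial `w_{u_1} ⋯ w_{u_d}`), `content_cons`,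
  `content_insertNth`, `content_comp_equiv`, `content_update_add`, **`isMConvex_range_content`** (the set of contents
  of words of a fixed length is M-convex — exchange a letter).
* §2 **`wordPolynomial d F = Σ_{u : Fin d → σ} F(u) · w^{content u}`** ("`Σ_{i_1,…,i_d} V(K_{i_1},…,K_{i_d}) w_{i_1}⋯w_{i_d}`"):
  `coeff_wordPolynomial`, `eval_wordPolynomial` (`= Σ_u F(u) Π_k w_{u_k}`), `isHomogeneous_wordPolynomial`,
  nonnegativity / positivity of coefficients, `support_wordPolynomial` (`= range content` for positive `F`).
* §3 **`pderiv_wordPolynomial`**: for SYMMETRIC `F` of arity `d + 1`, `∂_i (Σ_u F(u) w_u) = (d+1) · Σ_v F(i, v) w_v`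
  (the combinatorial form of "`D_i D_j D_3 ⋯ D_d f = d! F_f(v_i, v_j, v_3, …)`"), and `hessian_wordPolynomial_two`
  (`𝓗 (Σ_{a,b} F(a,b) w_a w_b) = 2 · (F(a,b))_{a,b}`).
* §4 `sigPos_smul_of_pos`, `smul_mem_lorentzian` (`L^d_n` is a cone), and the theorem
  **`wordPolynomial_mem_lorentzian`**: `F` symmetric with `F > 0` and every `2`-slice `(a,b) ↦ F(τ, a, b)`
  (`τ ∈ [n]^{d-2}`) of `sigPos ≤ 1` ⇒ `Σ_u F(u) w_u ∈ L^d_n` (induction along Def. 2.6 with §3); degrees `0, 1`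
  separately (`wordPolynomial_mem_lorentzian_zero/one`).

Theorems and two definitions with bodies (`content`, `wordPolynomial`); no `sorry`, no named fact (net debt 0).

## References

* [BrandenHuh2019] P. Brändén, J. Huh, *Lorentzian polynomials*, Ann. of Math. (2) 192 (2020), arXiv:1902.03719 —
  §2.2 Def. 2.6; §4.1 (p. 46 formula for `vol_K`), Thm. 4.1 and its proof (p. 47), Prop. 4.5 (p. 48); §4.2 Thm. 4.6 and
  its proof (pp. 49–50).
* [ShenfeldVanHandel2019] Y. Shenfeld, R. van Handel, *Mixed volumes and the Bochner method*, Proc. AMS 147 (2019),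
  Lemma 2.9 (the reading `sigPos ≤ 1` of "at most one positive eigenvalue").
-/

noncomputable section

open MvPolynomial Finsupp
open scoped Nat

namespace Literature.Combinatorics.LorentzianPolynomials

variable {σ : Type*}

/-! ## §1 The content `Σ_k e_{u_k}` of a word -/

section Content

variable {d : ℕ}

/-- **The content of a word** `u = (u_1, …, u_d) ∈ σ^d`: the exponent `Σ_k e_{u_k} ∈ Δ^d` of the monomial
`w_{u_1} ⋯ w_{u_d} = w^{content u}`. [cite: BrandenHuh2019, §4.1 (p. 46, "`w_{i_1} ⋯ w_{i_d}` […] `w^α`")] -/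
def content (u : Fin d → σ) : σ →₀ ℕ := ∑ k, Finsupp.single (u k) 1

/-- `content u = Σ_k e_{u_k}`. [cite: BrandenHuh2019, §4.1 (p. 46)] -/
theorem content_def (u : Fin d → σ) : content u = ∑ k, Finsupp.single (u k) 1 := rfl

/-- `|content u| = d`. [cite: BrandenHuh2019, §4.1 (p. 46)] -/
theorem degree_content (u : Fin d → σ) : (content u).degree = d := by
  rw [content, map_sum]
  simp

/-- `content (i, v) = e_i + content v`. [cite: BrandenHuh2019, §4.1 (p. 46)] -/
theorem content_cons (i : σ) (v : Fin d → σ) : content (Fin.cons i v : Fin (d + 1) → σ) = Finsupp.single i 1 + content v := by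
  rw [content, Fin.sum_univ_succ, Fin.cons_zero]
  simp only [Fin.cons_succ]
  rfl

/-- Inserting a letter `i` at position `k` adds `e_i` to the content. [cite: BrandenHuh2019, §4.1 (p. 46)] -/
theorem content_insertNth (k : Fin (d + 1)) (i : σ) (v : Fin d → σ) :
    content (Fin.insertNth k i v : Fin (d + 1) → σ) = content v + Finsupp.single i 1 := by
  rw [content, Fin.sum_univ_succAbove _ k, Fin.insertNth_apply_same, add_comm]
  simp only [Fin.insertNth_apply_succAbove]
  rfl

/-- The content is invariant under permuting the letters. [cite: BrandenHuh2019, §4.1 (p. 46, "symmetric in its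
arguments")] -/
theorem content_comp_equiv (u : Fin d → σ) (e : Equiv.Perm (Fin d)) : content (u ∘ e) = content u := by
  rw [content, content]
  exact Equiv.sum_comp e (fun k ↦ Finsupp.single (u k) 1)

/-- `(content u)_i = #{k | u_k = i}` read additively: `(content u) i = Σ_k [u_k = i]`. [cite: BrandenHuh2019, §4.1 (p. 46)] -/
theorem content_apply [DecidableEq σ] (u : Fin d → σ) (i : σ) :
    content u i = ∑ k, if u k = i then 1 else 0 := by
  rw [content, Finsupp.finsetSum_apply]
  refine Finset.sum_congr rfl fun k _ ↦ ?_
  rw [Finsupp.single_apply]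

/-- A letter of the content occurs in the word. [cite: BrandenHuh2019, §4.1 (p. 46)] -/
theorem exists_apply_eq_of_content_ne_zero [DecidableEq σ] {u : Fin d → σ} {i : σ} (h : content u i ≠ 0) :
    ∃ k, u k = i := by
  by_contra hne
  push Not at hne
  apply h
  rw [content_apply]
  exact Finset.sum_eq_zero fun k _ ↦ if_neg (hne k)

/-- Replacing the letter at position `k` by `j`: `content (u[k ↦ j]) + e_{u_k} = content u + e_j`.
[cite: BrandenHuh2019, §2.2 (p. 11, the exchange `α - e_i + e_j`)] -/
theorem content_update_add [DecidableEq σ] (u : Fin d → σ) (k : Fin d) (j : σ) :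
    content (Function.update u k j) + Finsupp.single (u k) 1 = content u + Finsupp.single j 1 := by
  cases d with
  | zero => exact k.elim0
  | succ d =>
    rw [content, content, Fin.sum_univ_succAbove _ k, Fin.sum_univ_succAbove _ k, Function.update_self]
    have h : ∀ l : Fin d, Function.update u k j (k.succAbove l) = u (k.succAbove l) :=
      fun l ↦ Function.update_of_ne (Fin.succAbove_ne k l) j u
    simp only [h]
    abel

/-- **The contents of the words of length `d` form an M-convex set** (exchange property: if `content u` has more
`i`'s than `content u'`, some letter `j` is rarer, and replacing one `i` of `u` by `j` realizes `α - e_i + e_j`).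
[cite: BrandenHuh2019, §2.2 (p. 11, exchange property; §4.1 Cor. 4.2: "the support of `vol_K` is M-convex")] -/
theorem isMConvex_range_content [DecidableEq σ] (d : ℕ) : IsMConvex (Set.range (content : (Fin d → σ) → σ →₀ ℕ)) := by
  rintro α β ⟨u, rfl⟩ ⟨u', rfl⟩ i hi
  -- a rarer letter `j`
  have hex : ∃ j, content u j < content u' j := by
    by_contra h
    push Not at h
    have hlt := degree_lt_degree_of_le_of_lt (α := content u) (β := content u') (fun k ↦ h k) hi
    rw [degree_content, degree_content] at hlt
    exact lt_irrefl _ hlt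
  obtain ⟨j, hj⟩ := hex
  refine ⟨j, hj, ?_⟩
  -- replace one occurrence of `i` by `j`
  have hi0 : content u i ≠ 0 := by omega
  obtain ⟨k, hk⟩ := exists_apply_eq_of_content_ne_zero hi0
  refine ⟨Function.update u k j, ?_⟩
  have h := content_update_add u k j
  rw [hk] at h
  rw [sub_single_one_add hi0, ← h, add_tsub_cancel_right]

end Content

/-! ## §2 The polynomial of a function of words -/

section WordPolynomial

variable [Fintype σ] {d : ℕ}

/-- **`Σ_{u ∈ σ^d} F(u) w_{u_1} ⋯ w_{u_d}`** — the homogeneous degree-`d` polynomial attached to a function `F` of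
words of length `d` (Brändén–Huh's "`vol_K(w) = Σ_{1 ≤ i_1, …, i_d ≤ n} V(K_{i_1}, …, K_{i_d}) w_{i_1} ⋯ w_{i_d}`" with
`V(K_{i_1}, …, K_{i_d})` replaced by `F(i_1, …, i_d)`). [cite: BrandenHuh2019, §4.1 (p. 46)] -/
def wordPolynomial (d : ℕ) (F : (Fin d → σ) → ℝ) : MvPolynomial σ ℝ :=
  ∑ u : Fin d → σ, monomial (content u) (F u)

/-- `Σ_u F(u) w_u` unfolded. [cite: BrandenHuh2019, §4.1 (p. 46)] -/
theorem wordPolynomial_def (F : (Fin d → σ) → ℝ) :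
    wordPolynomial d F = ∑ u : Fin d → σ, monomial (content u) (F u) := rfl

variable [DecidableEq σ]

/-- `coeff_α (Σ_u F(u) w_u) = Σ_{content u = α} F(u)`. [cite: BrandenHuh2019, §4.1 (p. 46)] -/
theorem coeff_wordPolynomial (F : (Fin d → σ) → ℝ) (α : σ →₀ ℕ) :
    coeff α (wordPolynomial d F) = ∑ u : Fin d → σ, if content u = α then F u else 0 := by
  rw [wordPolynomial, coeff_sum]
  exact Finset.sum_congr rfl fun u _ ↦ coeff_monomial _ _ _

omit [DecidableEq σ] in
/-- `(Σ_u F(u) w_u)(w) = Σ_u F(u) Π_k w_{u_k}`. [cite: BrandenHuh2019, §4.1 (p. 46, "`w_{i_1} ⋯ w_{i_d}`")] -/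
theorem eval_wordPolynomial (F : (Fin d → σ) → ℝ) (w : σ → ℝ) :
    eval w (wordPolynomial d F) = ∑ u : Fin d → σ, F u * ∏ k, w (u k) := by
  rw [wordPolynomial, map_sum]
  refine Finset.sum_congr rfl fun u _ ↦ ?_
  rw [eval_monomial, content, ← Finsupp.prod_finsetSum_index (fun _ ↦ pow_zero _) (fun _ _ _ ↦ pow_add _ _ _)]
  simp

omit [DecidableEq σ] in
/-- `Σ_u F(u) w_u` is homogeneous of degree `d`. [cite: BrandenHuh2019, §4.1 (p. 46, "degree `d` homogeneous polynomial")] -/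
theorem isHomogeneous_wordPolynomial (F : (Fin d → σ) → ℝ) : (wordPolynomial d F).IsHomogeneous d := by
  rw [wordPolynomial]
  exact IsHomogeneous.sum _ _ _ fun u _ ↦ isHomogeneous_monomial _ (degree_content u)

/-- Nonnegative values give nonnegative coefficients. [cite: BrandenHuh2019, §4.1 (p. 46, "nonnegative coefficients")] -/
theorem coeff_wordPolynomial_nonneg {F : (Fin d → σ) → ℝ} (hF : ∀ u, 0 ≤ F u) (α : σ →₀ ℕ) :
    0 ≤ coeff α (wordPolynomial d F) := by
  rw [coeff_wordPolynomial]
  exact Finset.sum_nonneg fun u _ ↦ by split_ifs <;> simp [hF u]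

/-- For positive values, `coeff_α > 0` exactly when `α` is the content of a word ("every coefficient of `vol` is
positive"). [cite: BrandenHuh2019, §4.1 proof of Thm. 4.1 (p. 47); §4.2 proof of Thm. 4.6 (p. 49)] -/
theorem coeff_wordPolynomial_pos_iff {F : (Fin d → σ) → ℝ} (hF : ∀ u, 0 < F u) {α : σ →₀ ℕ} :
    0 < coeff α (wordPolynomial d F) ↔ ∃ u : Fin d → σ, content u = α := by
  rw [coeff_wordPolynomial]
  constructor
  · intro h
    by_contra hne
    push Not at hne
    refine (lt_irrefl (0 : ℝ)) (h.trans_le (le_of_eq (Finset.sum_eq_zero fun u _ ↦ if_neg (hne u))))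
  · rintro ⟨u, hu⟩
    refine lt_of_lt_of_le (hF u) ?_
    rw [← Finset.sum_erase_add _ _ (Finset.mem_univ u), if_pos hu]
    refine le_add_of_nonneg_left (Finset.sum_nonneg fun v _ ↦ ?_)
    split_ifs <;> simp [(hF v).le]

/-- The support of `Σ_u F(u) w_u` for positive `F` is the set of contents of words of length `d`.
[cite: BrandenHuh2019, §4.1 Cor. 4.2 (p. 46, "the support of `vol_K`")] -/
theorem support_wordPolynomial {F : (Fin d → σ) → ℝ} (hF : ∀ u, 0 < F u) :
    {α | coeff α (wordPolynomial d F) ≠ 0} = Set.range (content : (Fin d → σ) → σ →₀ ℕ) := by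
  ext α
  rw [Set.mem_setOf_eq, Set.mem_range, ← coeff_wordPolynomial_pos_iff hF]
  have h0 := coeff_wordPolynomial_nonneg (fun u ↦ (hF u).le) α
  exact ⟨fun h ↦ lt_of_le_of_ne h0 (Ne.symm h), fun h ↦ h.ne'⟩

end WordPolynomial

/-! ## §3 `∂_i` of the polynomial of a SYMMETRIC function of words, and its Hessian in degree `2` -/

section Derivative

variable [Fintype σ] [DecidableEq σ] {d : ℕ}

omit [Fintype σ] [DecidableEq σ] in
/-- Inserting the letter `x` at position `k` is the word `(x, v)` read through a permutation of the positions.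
[cite: BrandenHuh2019, §4.1 (p. 46, "symmetric in its arguments")] -/
theorem insertNth_eq_cons_comp (k : Fin (d + 1)) (x : σ) (v : Fin d → σ) :
    ∃ e : Equiv.Perm (Fin (d + 1)), (Fin.insertNth k x v : Fin (d + 1) → σ) = (Fin.cons x v : Fin (d + 1) → σ) ∘ e := by
  refine ⟨(finSuccEquiv' k).trans (finSuccEquiv d).symm, funext fun y ↦ ?_⟩
  refine (Fin.forall_iff_succAbove k (P := fun y ↦ (Fin.insertNth k x v : Fin (d + 1) → σ) y =
    ((Fin.cons x v : Fin (d + 1) → σ) ∘ ((finSuccEquiv' k).trans (finSuccEquiv d).symm)) y)).2 ⟨?_, fun j ↦ ?_⟩ y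
  · rw [Fin.insertNth_apply_same, Function.comp_apply, Equiv.trans_apply, finSuccEquiv'_at, finSuccEquiv_symm_none,
      Fin.cons_zero]
  · rw [Fin.insertNth_apply_succAbove, Function.comp_apply, Equiv.trans_apply, finSuccEquiv'_succAbove,
      finSuccEquiv_symm_some, Fin.cons_succ]

omit [Fintype σ] [DecidableEq σ] in
/-- A symmetric function of words takes the same value on `insertNth k x v` and on `(x, v)`.
[cite: BrandenHuh2019, §4.1 (p. 46, "the mixed volume […] is symmetric in its arguments")] -/
theorem apply_insertNth_of_symmetric {F : (Fin (d + 1) → σ) → ℝ}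
    (hF : ∀ (e : Equiv.Perm (Fin (d + 1))) (u : Fin (d + 1) → σ), F (u ∘ e) = F u)
    (k : Fin (d + 1)) (x : σ) (v : Fin d → σ) : F (Fin.insertNth k x v) = F (Fin.cons x v) := by
  obtain ⟨e, he⟩ := insertNth_eq_cons_comp k x v
  rw [he, hF]

/-- **`∂_i (Σ_{u ∈ σ^{d+1}} F(u) w_u) = (d+1) · Σ_{v ∈ σ^d} F(i, v) w_v` for symmetric `F`** — each of the `d + 1`
positions of the letter `i` contributes the same polynomial (the combinatorial content of Brändén–Huh's
"`v_i^T 𝓗 v_j = D_i D_j D_3 ⋯ D_d f = d! F_f(v_i, v_j, v_3, …, v_d)`" and of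
"`(2!/d!) ∂^α vol_H(w) = (Σ_i w_i H_i · Σ_i w_i H_i · H_1 ⋯ H_n)`"). [cite: BrandenHuh2019, §4.1 proof of Prop. 4.5
(p. 48); §4.2 proof of Thm. 4.6 (pp. 49–50)] -/
theorem pderiv_wordPolynomial (F : (Fin (d + 1) → σ) → ℝ)
    (hF : ∀ (e : Equiv.Perm (Fin (d + 1))) (u : Fin (d + 1) → σ), F (u ∘ e) = F u) (i : σ) :
    pderiv i (wordPolynomial (d + 1) F) = (d + 1) • wordPolynomial d (fun v ↦ F (Fin.cons i v)) := by
  -- `∂_i w^{content u} = (content u)_i w^{content u - e_i}` and `(content u)_i = Σ_k [u_k = i]`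
  have h1 : pderiv i (wordPolynomial (d + 1) F) =
      ∑ u : Fin (d + 1) → σ, ∑ k : Fin (d + 1),
        if u k = i then monomial (content u - Finsupp.single i 1) (F u) else 0 := by
    rw [wordPolynomial, map_sum]
    refine Finset.sum_congr rfl fun u _ ↦ ?_
    rw [pderiv_monomial, content_apply, Nat.cast_sum, Finset.mul_sum, map_sum]
    refine Finset.sum_congr rfl fun k _ ↦ ?_
    split_ifs <;> simp
  rw [h1, Finset.sum_comm]
  -- for each position `k`, reindex the words with `u_k = i` by `v ↦ insertNth k i v`
  have h2 : ∀ k : Fin (d + 1),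
      (∑ u : Fin (d + 1) → σ, if u k = i then monomial (content u - Finsupp.single i 1) (F u) else 0) =
        wordPolynomial d (fun v ↦ F (Fin.cons i v)) := by
    intro k
    rw [wordPolynomial, ← (Fin.insertNthEquiv (fun _ ↦ σ) k).sum_comp, Fintype.sum_prod_type, Finset.sum_comm]
    refine Finset.sum_congr rfl fun v _ ↦ ?_
    have happ : ∀ x : σ, (Fin.insertNthEquiv (fun _ ↦ σ) k) (x, v) = Fin.insertNth k x v := fun x ↦ rfl
    simp_rw [happ, Fin.insertNth_apply_same]
    rw [Finset.sum_ite_eq' Finset.univ i, if_pos (Finset.mem_univ i), content_insertNth, add_tsub_cancel_right,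
      apply_insertNth_of_symmetric hF]
  simp_rw [h2]
  rw [Finset.sum_const, Finset.card_univ, Fintype.card_fin]

omit [Fintype σ] [DecidableEq σ] in
/-- `(b, a) = (a, b) ∘ swap` on words of length `2`. [cite: BrandenHuh2019, §4.1 (p. 46)] -/
theorem vecCons_swap (a b : σ) : (![b, a] : Fin 2 → σ) = (![a, b] : Fin 2 → σ) ∘ (Equiv.swap 0 1) := by
  funext k
  fin_cases k <;> rfl

/-- **The Hessian of `Σ_{a,b} F(a,b) w_a w_b` is `2 · (F(a,b))_{a,b}` for symmetric `F`** (diagonal: `∂_a² F(a,a) w_a² =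
2 F(a,a)`; off-diagonal: `∂_a ∂_b (F(a,b) + F(b,a)) w_a w_b = 2 F(a,b)`). [cite: BrandenHuh2019, §4.1 proof of Prop. 4.5
(p. 48, "`v_i^T 𝓗 v_j = […] = d! F_f(v_i, v_j, …)`" at `d = 2`)] -/
theorem hessian_wordPolynomial_two (F : (Fin 2 → σ) → ℝ)
    (hF : ∀ (e : Equiv.Perm (Fin 2)) (u : Fin 2 → σ), F (u ∘ e) = F u) :
    hessian (wordPolynomial 2 F) = (2 : ℝ) • Matrix.of fun a b ↦ F ![a, b] := by
  ext a b
  rw [Matrix.smul_apply, Matrix.of_apply, hessian_apply_eq_normCoeff, normCoeff_def, coeff_wordPolynomial,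
    ← (finTwoArrowEquiv σ).symm.sum_comp, Fintype.sum_prod_type]
  simp only [finTwoArrowEquiv_symm_apply, content, Fin.sum_univ_two, Matrix.cons_val_zero, Matrix.cons_val_one]
  have key : ∀ x y : σ, (Finsupp.single x 1 + Finsupp.single y 1 = Finsupp.single a 1 + Finsupp.single b (1 : ℕ)) ↔
      (x = a ∧ y = b) ∨ (x = b ∧ y = a) := by
    intro x y
    rw [Finsupp.single_add_single_eq_single_add_single one_ne_zero one_ne_zero]
    constructor
    · rintro (h | ⟨-, h1, h2⟩ | ⟨h, -⟩)
      · exact Or.inl h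
      · exact Or.inr ⟨h1, h2⟩
      · exact absurd h (by norm_num)
    · rintro (h | ⟨h1, h2⟩)
      · exact Or.inl h
      · exact Or.inr (Or.inl ⟨rfl, h1, h2⟩)
  simp_rw [key]
  by_cases hab : a = b
  · subst hab
    simp_rw [or_self]
    rw [Finset.sum_eq_single a (fun x _ hx ↦ Finset.sum_eq_zero fun y _ ↦ if_neg fun h ↦ hx h.1)
      (fun h ↦ absurd (Finset.mem_univ a) h), Finset.sum_eq_single a (fun y _ hy ↦ if_neg fun h ↦ hy h.2)
      (fun h ↦ absurd (Finset.mem_univ a) h), if_pos ⟨rfl, rfl⟩]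
    have hfac : factorialProd (Finsupp.single a 1 + Finsupp.single a (1 : ℕ)) = 2 := by
      rw [← Finsupp.single_add, factorialProd]
      rw [Finset.prod_eq_single a (fun x _ hx ↦ by rw [Finsupp.single_eq_of_ne hx, Nat.factorial_zero, Nat.cast_one])
        (fun h ↦ absurd (Finset.mem_univ a) h), Finsupp.single_eq_same]
      norm_num [Nat.factorial]
    rw [hfac, smul_eq_mul]
  · have hfac : factorialProd (Finsupp.single a 1 + Finsupp.single b (1 : ℕ)) = 1 := by
      rw [factorialProd]
      refine Finset.prod_eq_one fun x _ ↦ ?_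
      rw [Finsupp.add_apply, Finsupp.single_apply, Finsupp.single_apply]
      split_ifs with h1 h2
      · exact absurd (h1.trans h2.symm) hab
      · simp
      · simp
      · simp
    rw [hfac, one_mul]
    -- the double sum has exactly the two terms `(a, b)` and `(b, a)`
    rw [Finset.sum_eq_add_of_mem a b (Finset.mem_univ a) (Finset.mem_univ b) hab (fun x _ hx ↦
      Finset.sum_eq_zero fun y _ ↦ if_neg (by rintro (⟨h, -⟩ | ⟨h, -⟩) <;> [exact hx.1 h; exact hx.2 h]))]
    rw [Finset.sum_eq_single b (fun y _ hy ↦ if_neg (by rintro (⟨-, h⟩ | ⟨h, -⟩) <;> [exact hy h; exact hab h]))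
      (fun h ↦ absurd (Finset.mem_univ b) h), if_pos (Or.inl ⟨rfl, rfl⟩)]
    rw [Finset.sum_eq_single a (fun y _ hy ↦ if_neg (by rintro (⟨h, -⟩ | ⟨-, h⟩) <;> [exact hab h.symm; exact hy h]))
      (fun h ↦ absurd (Finset.mem_univ a) h), if_pos (Or.inr ⟨rfl, rfl⟩)]
    rw [vecCons_swap a b, hF, smul_eq_mul, two_mul]

end Derivative

/-! ## §4 `L^d_n` is a cone; the Lorentzian property of `Σ_u F(u) w_u` -/

section Lorentzian

/-- `sigPos (c · Q) = sigPos Q` for `c > 0` (the same subspaces are positive definite). [folklore] -/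
private theorem sigPos_smul_of_pos {V : Type*} [AddCommGroup V] [Module ℝ V] [FiniteDimensional ℝ V]
    (Q : QuadraticForm ℝ V) {c : ℝ} (hc : 0 < c) : sigPos (c • Q) = sigPos Q := by
  apply le_antisymm
  · obtain ⟨W, hW, hpos⟩ := exists_finrank_eq_sigPos_and_posDef (c • Q)
    rw [← hW]
    refine le_sigPos_of_posDef Q fun x hx ↦ ?_
    have h := hpos x hx
    simp only [QuadraticMap.restrict_apply, QuadraticMap.smul_apply, smul_eq_mul] at h ⊢
    exact pos_of_mul_pos_right h hc.le
  · obtain ⟨W, hW, hpos⟩ := exists_finrank_eq_sigPos_and_posDef Q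
    rw [← hW]
    refine le_sigPos_of_posDef (c • Q) fun x hx ↦ ?_
    have h := hpos x hx
    simp only [QuadraticMap.restrict_apply, QuadraticMap.smul_apply, smul_eq_mul] at h ⊢
    exact mul_pos hc h

variable [Fintype σ] [DecidableEq σ]

omit [DecidableEq σ] in
/-- The Hessian is linear: `𝓗_{c f} = c 𝓗_f`. [cite: BrandenHuh2019, §2.1 (p. 8)] -/
theorem hessian_smul (c : ℝ) (f : MvPolynomial σ ℝ) : hessian (c • f) = c • hessian f := by
  ext i j
  rw [Matrix.smul_apply, hessian_apply_eq_normCoeff, hessian_apply_eq_normCoeff, normCoeff_smul, smul_eq_mul]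

/-- **`L^d_n` is a cone**: `c · f ∈ L^d_n` for `f ∈ L^d_n` and `c ≥ 0` (coefficients, support and the eigenvalue condition
scale). [cite: BrandenHuh2019, §2.2 Def. 2.6 (p. 12); §2.4 (p. 25, `ℙL^d_n`: "`L^d_n` […] closed under multiplication by
positive scalars" is implicit in projectivizing)] -/
theorem smul_mem_lorentzian : ∀ {d : ℕ} {f : MvPolynomial σ ℝ}, f ∈ lorentzian σ d → ∀ {c : ℝ}, 0 ≤ c →
    c • f ∈ lorentzian σ d := by
  -- `c = 0` is the zero polynomial; for `c > 0` nothing changes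
  suffices h : ∀ (d : ℕ) {f : MvPolynomial σ ℝ}, f ∈ lorentzian σ d → ∀ {c : ℝ}, 0 < c → c • f ∈ lorentzian σ d by
    intro d f hf c hc
    rcases hc.eq_or_lt with rfl | hc'
    · rw [zero_smul]; exact zero_mem_lorentzian d
    · exact h d hf hc'
  have hhom : ∀ {d : ℕ} {f : MvPolynomial σ ℝ} (c : ℝ), f.IsHomogeneous d → (c • f).IsHomogeneous d :=
    fun c hf ↦ (homogeneousSubmodule σ ℝ _).smul_mem c hf
  have hnn : ∀ {f : MvPolynomial σ ℝ} {c : ℝ}, 0 < c → (∀ α, 0 ≤ coeff α f) → ∀ α, 0 ≤ coeff α (c • f) :=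
    fun hc hf α ↦ by rw [coeff_smul, smul_eq_mul]; exact mul_nonneg hc.le (hf α)
  have hsupp : ∀ {f : MvPolynomial σ ℝ} {c : ℝ}, 0 < c → {α | coeff α (c • f) ≠ 0} = {α | coeff α f ≠ 0} :=
    fun hc ↦ Set.ext fun α ↦ by rw [Set.mem_setOf_eq, Set.mem_setOf_eq, coeff_smul, smul_eq_mul, mul_ne_zero_iff,
      and_iff_right hc.ne']
  intro d
  induction d using Nat.strong_induction_on with
  | _ d ih =>
    intro f hf c hc
    match d, hf, ih with
    | 0, hf, _ => exact ⟨hhom c hf.1, hnn hc hf.2⟩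
    | 1, hf, _ => exact ⟨hhom c hf.1, hnn hc hf.2⟩
    | 2, hf, _ =>
      obtain ⟨h1, h2, h3, h4⟩ := hf
      refine ⟨hhom c h1, hnn hc h2, by rw [hsupp hc]; exact h3, ?_⟩
      rw [hessian_smul, map_smul, LinearMap.BilinMap.toQuadraticMap_smul, sigPos_smul_of_pos _ hc]
      exact h4
    | d + 3, hf, ih =>
      obtain ⟨h1, h2, h3, h4⟩ := hf
      refine ⟨hhom c h1, hnn hc h2, by rw [hsupp hc]; exact h3, fun i ↦ ?_⟩
      rw [(pderiv i).map_smul]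
      exact ih (d + 2) (by omega) (h4 i) hc

/-- `n • f ∈ L^d_n` for `f ∈ L^d_n`. [cite: BrandenHuh2019, §2.2 Def. 2.6 (p. 12)] -/
theorem nsmul_mem_lorentzian {d : ℕ} {f : MvPolynomial σ ℝ} (hf : f ∈ lorentzian σ d) (n : ℕ) :
    n • f ∈ lorentzian σ d := by
  rw [← Nat.cast_smul_eq_nsmul ℝ]
  exact smul_mem_lorentzian hf n.cast_nonneg

/-- `Σ_u F(u) w_u ∈ L^0_n` for positive `F` (a positive constant). [cite: BrandenHuh2019, §2.2 Def. 2.6 (p. 11, `L^0_n`)] -/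
theorem wordPolynomial_mem_lorentzian_zero {F : (Fin 0 → σ) → ℝ} (hpos : ∀ u, 0 ≤ F u) :
    wordPolynomial 0 F ∈ lorentzian σ 0 :=
  ⟨isHomogeneous_wordPolynomial F, coeff_wordPolynomial_nonneg hpos⟩

/-- `Σ_u F(u) w_u ∈ L^1_n` for positive `F` (a linear form with nonnegative coefficients).
[cite: BrandenHuh2019, §2.2 Def. 2.6 (p. 11, `L^1_n`)] -/
theorem wordPolynomial_mem_lorentzian_one {F : (Fin 1 → σ) → ℝ} (hpos : ∀ u, 0 ≤ F u) :
    wordPolynomial 1 F ∈ lorentzian σ 1 :=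
  ⟨isHomogeneous_wordPolynomial F, coeff_wordPolynomial_nonneg hpos⟩

omit [Fintype σ] [DecidableEq σ] in
/-- Fixing the first letter of a symmetric function of words gives a symmetric function of shorter words.
[cite: BrandenHuh2019, §4.1 (p. 46, "symmetric in its arguments")] -/
theorem symmetric_cons {d : ℕ} {F : (Fin (d + 1) → σ) → ℝ}
    (hF : ∀ (e : Equiv.Perm (Fin (d + 1))) (u : Fin (d + 1) → σ), F (u ∘ e) = F u) (i : σ)
    (e : Equiv.Perm (Fin d)) (v : Fin d → σ) : F (Fin.cons i (v ∘ e)) = F (Fin.cons i v) := by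
  -- extend `e` to a permutation of `Fin (d+1)` fixing `0`
  set e' : Equiv.Perm (Fin (d + 1)) := (finSuccEquiv d).trans (e.optionCongr.trans (finSuccEquiv d).symm) with he'
  have h : (Fin.cons i (v ∘ e) : Fin (d + 1) → σ) = (Fin.cons i v : Fin (d + 1) → σ) ∘ e' := by
    funext y
    refine Fin.cases ?_ (fun j ↦ ?_) y
    · rw [Fin.cons_zero, Function.comp_apply, he', Equiv.trans_apply, finSuccEquiv_zero, Equiv.trans_apply,
        Equiv.optionCongr_apply, Option.map_none, finSuccEquiv_symm_none, Fin.cons_zero]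
    · rw [Fin.cons_succ, Function.comp_apply, Function.comp_apply, he', Equiv.trans_apply, finSuccEquiv_succ,
        Equiv.trans_apply, Equiv.optionCongr_apply, Option.map_some, finSuccEquiv_symm_some, Fin.cons_succ]
  rw [h, hF]

/-- **The common skeleton of Theorems 4.1 and 4.6: a SYMMETRIC, POSITIVE function `F` of words of length `d = m + 2`
all of whose `2`-slices `(a, b) ↦ F(τ, a, b)` (`τ ∈ σ^m`) are quadratic forms with at most one positive eigenvalue
(`sigPos ≤ 1`) has `Σ_u F(u) w_u ∈ L^d_n`.** ("every coefficient of `vol` is positive […] it is enough to show that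
`∂^α vol` [has at most one positive eigenvalue]; `(2!/d!) ∂^α vol(w) = V(Σ w_i K_i, Σ w_i K_i, K^α)`" — run here along
the recursion of Def. 2.6: the support is the M-convex set of contents, and `∂_i (Σ_u F(u) w_u) = d · Σ_v F(i,v) w_v`
is the polynomial of the symmetric positive function `F(i, ·)` with the same slices.) For Thm. 4.1 `F` = mixed volumes
and the slice condition is the Alexandrov–Fenchel inequality; for Thm. 4.6 `F` = intersection numbers of nef divisors
and the slice condition is the Hodge index theorem. [cite: BrandenHuh2019, §4.1 Thm. 4.1 and its proof (pp. 46–47);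
§4.2 Thm. 4.6 and its proof (pp. 49–50); §2.2 Def. 2.6 (p. 12)] [cite: ShenfeldVanHandel2019, Lemma 2.9] -/
theorem wordPolynomial_mem_lorentzian : ∀ (m : ℕ) (F : (Fin (m + 2) → σ) → ℝ),
    (∀ (e : Equiv.Perm (Fin (m + 2))) (u : Fin (m + 2) → σ), F (u ∘ e) = F u) → (∀ u, 0 < F u) →
    (∀ τ : Fin m → σ,
      sigPos (Matrix.toBilin' (Matrix.of fun a b : σ ↦ F (Fin.append τ ![a, b]))).toQuadraticMap ≤ 1) →
    wordPolynomial (m + 2) F ∈ lorentzian σ (m + 2)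
  | 0, F, hF, hpos, hH => by
    refine ⟨isHomogeneous_wordPolynomial F, coeff_wordPolynomial_nonneg fun u ↦ (hpos u).le, ?_, ?_⟩
    · rw [support_wordPolynomial hpos]; exact isMConvex_range_content 2
    · have h := hH Fin.elim0
      have hm : (Matrix.of fun a b : σ ↦ F (Fin.append Fin.elim0 ![a, b])) = Matrix.of fun a b : σ ↦ F ![a, b] :=
        Matrix.ext fun a b ↦ by rw [Matrix.of_apply, Matrix.of_apply, Fin.elim0_append]; rfl
      rw [hm] at h
      rw [hessian_wordPolynomial_two F hF, map_smul, LinearMap.BilinMap.toQuadraticMap_smul,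
        sigPos_smul_of_pos _ two_pos]
      exact h
  | m + 1, F, hF, hpos, hH => by
    refine ⟨isHomogeneous_wordPolynomial F, coeff_wordPolynomial_nonneg fun u ↦ (hpos u).le, ?_, fun i ↦ ?_⟩
    · rw [support_wordPolynomial hpos]; exact isMConvex_range_content (m + 3)
    · rw [pderiv_wordPolynomial F hF i]
      refine nsmul_mem_lorentzian (wordPolynomial_mem_lorentzian m (fun v ↦ F (Fin.cons i v))
        (fun e v ↦ symmetric_cons hF i e v) (fun v ↦ hpos _) fun τ ↦ ?_) (m + 2 + 1)
      have hm : (Matrix.of fun a b : σ ↦ F (Fin.cons i (Fin.append τ ![a, b]))) =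
          Matrix.of fun a b : σ ↦ F (Fin.append (Fin.cons i τ) ![a, b]) :=
        Matrix.ext fun a b ↦ by rw [Matrix.of_apply, Matrix.of_apply, Fin.append_cons]; rfl
      rw [hm]
      exact hH (Fin.cons i τ)

end Lorentzian

end Literature.Combinatorics.LorentzianPolynomials

end
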